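import Summits.Ventures.PercRepro.RankLevelSetRuleQSliceThreeChain

/-!
# PercRepro — THE CONTRACTION CHAIN FOR THE CELL `m = 2` OF EVERY SLICE (night-1, gen 21; dossier §32.3)

The `m = 2` companion of RankLevelSetRuleQSliceThreeChain. With `q = u + 2`, `T_u(2) = sliceTail u k 2 = Σ_{i ≤ u} sliceTwoTerm u k i`,
`sliceTwoTerm u k i = C(u+k, k+i)·Σ_{a ≤ 2} C(2, a)/C(2+u+(k+i)+a, a+(k+i))`:
* **`sliceTwoTerm_succ_le`** — the terms contract by `P₂(u, k) = u(k+3)/((k+1)(u+k+5))` (termwise in `a ≤ 2`: the `a`-factor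
  `(k+i+a+1)/(u+k+3+i+a) ≤ (k+i+3)/(u+k+5+i)` and `P(i) = (u−i)(k+i+3)/((k+i+1)(u+k+5+i)) ≤ P(0)`, the difference
  `i·(2u² + u(2k²+10k+16) + (k+1)(k+3)(k+5)) + i²·(u(k+3) + (k+1)(u+k+5)) ≥ 0`);
* **`sliceTwoTerm_zero_eq`** — `sliceTwoTerm u k 0 = (u+1)(u+2)/((u+k+1)(u+k+2)) · (1 + 2x₁ + x₁x₂)`, `x_b = (k+b)/(u+k+2+b)`;
* **`sliceTail_two_le_chain`** — `P₂ < 1 ⇒ sliceTail u k 2 ≤ sliceTwoTerm u k 0 / (1 − P₂)`.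
At `m = 2` the tail exceeds `1` on the untruncated slices (`T_u(2) → 9/8` at `u = k − 1`, `≈ 1.06 … 1.10` at `u = k`), so the cell
needs the ρ-slack of the slice identity: RankLevelSetRuleQSliceSecondUntruncTwo. Axioms: standard.
-/

namespace PercRepro

open Finset

/-- The `i`-th term of `T_u(2) = sliceTail u k 2` (`j = k + i`, `q = u + 2`). -/
def sliceTwoTerm (u k i : ℕ) : ℚ :=
  ((u + k).choose (k + i) : ℚ)
    * ∑ a ∈ range (2 + 1), ((2 : ℕ).choose a : ℚ) / ((2 + u + (k + i) + a).choose (a + (k + i)) : ℚ)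

/-- `sliceTail u k 2 = Σ_{i ≤ u} sliceTwoTerm u k i`. -/
lemma sliceTail_two_eq (u k : ℕ) : sliceTail u k 2 = ∑ i ∈ range (u + 1), sliceTwoTerm u k i := by
  unfold sliceTail sliceTwoTerm
  have h : Finset.Icc k (u + k) = Finset.Ico k (u + k + 1) := by
    ext j; simp only [Finset.mem_Icc, Finset.mem_Ico]; omega
  rw [h, Finset.sum_Ico_eq_sum_range, show u + k + 1 - k = u + 1 by omega]

/-- The terms are nonnegative. -/
lemma sliceTwoTerm_nonneg (u k i : ℕ) : 0 ≤ sliceTwoTerm u k i := by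
  unfold sliceTwoTerm
  apply mul_nonneg (by positivity)
  apply Finset.sum_nonneg
  intro a _
  positivity

/-- The contraction ratio `P₂(u, k) = u(k+3)/((k+1)(u+k+5))`. -/
def twoRatio (u k : ℕ) : ℚ := ((u : ℚ) * ((k : ℚ) + 3)) / (((k : ℚ) + 1) * ((u : ℚ) + k + 5))

/-- `P₂ ≥ 0`. -/
lemma twoRatio_nonneg (u k : ℕ) : 0 ≤ twoRatio u k := by unfold twoRatio; positivity

/-- **The terms of `T_u(2)` contract by `P₂(u, k)`** for `i + 1 ≤ u`. -/
lemma sliceTwoTerm_succ_le (u k i : ℕ) (hi : i + 1 ≤ u) :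
    sliceTwoTerm u k (i + 1) ≤ twoRatio u k * sliceTwoTerm u k i := by
  unfold sliceTwoTerm
  rw [Finset.mul_sum, Finset.mul_sum, Finset.mul_sum]
  apply Finset.sum_le_sum
  intro a ha
  rw [Finset.mem_range] at ha
  rw [show k + (i + 1) = k + i + 1 by ring,
    show 2 + u + (k + i + 1) + a = 2 + u + (k + i) + a + 1 by ring,
    show a + (k + i + 1) = a + (k + i) + 1 by ring]
  have h1 := Nat.choose_succ_right_eq (u + k) (k + i)
  rw [show u + k - (k + i) = u - i by omega] at h1
  have hc1 := congrArg (fun x : ℕ => (x : ℚ)) h1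
  push_cast [Nat.cast_sub (by omega : i ≤ u)] at hc1
  have h2 := Nat.add_one_mul_choose_eq (2 + u + (k + i) + a) (a + (k + i))
  have hc2 := congrArg (fun x : ℕ => (x : ℚ)) h2
  push_cast at hc2
  have hB : (0 : ℚ) < ((2 + u + (k + i) + a).choose (a + (k + i)) : ℚ) :=
    Nat.cast_pos.mpr (Nat.choose_pos (by omega))
  have hB' : (0 : ℚ) < ((2 + u + (k + i) + a + 1).choose (a + (k + i) + 1) : ℚ) :=
    Nat.cast_pos.mpr (Nat.choose_pos (by omega))
  have hiu : (i : ℚ) + 1 ≤ u := by exact_mod_cast hi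
  have ha2 : (a : ℚ) ≤ 2 := by exact_mod_cast (by omega : a ≤ 2)
  have ha0 : (0 : ℚ) ≤ a := by positivity
  have hi0 : (0 : ℚ) ≤ i := by positivity
  have hu0 : (0 : ℚ) ≤ u := by positivity
  have hk0 : (0 : ℚ) ≤ k := by positivity
  have hpos1 : (0 : ℚ) < (k : ℚ) + i + 1 := by positivity
  have e1 : ((u + k).choose (k + i + 1) : ℚ) = ((u + k).choose (k + i) : ℚ) * (((u : ℚ) - i) / ((k : ℚ) + i + 1)) := by
    rw [mul_div_assoc', eq_div_iff hpos1.ne']; linarith [hc1]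
  have e2 : (1 : ℚ) / ((2 + u + (k + i) + a + 1).choose (a + (k + i) + 1) : ℚ)
      = ((((a + (k + i) : ℕ) : ℚ) + 1) / (((2 + u + (k + i) + a : ℕ) : ℚ) + 1))
          * (1 / ((2 + u + (k + i) + a).choose (a + (k + i)) : ℚ)) := by
    rw [div_mul_div_comm, mul_one, div_eq_div_iff hB'.ne' (mul_pos (by positivity) hB).ne']
    push_cast
    linarith [hc2]
  have hr : (((u : ℚ) - i) / ((k : ℚ) + i + 1))
      * ((((a + (k + i) : ℕ) : ℚ) + 1) / (((2 + u + (k + i) + a : ℕ) : ℚ) + 1)) ≤ twoRatio u k := by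
    push_cast
    -- the a-factor: (k+i+a+1)/(u+k+3+i+a) ≤ (k+i+3)/(u+k+5+i)
    have hA : ((a : ℚ) + (k + i) + 1) / (2 + (u : ℚ) + (k + i) + a + 1) ≤ ((k : ℚ) + i + 3) / ((u : ℚ) + k + 5 + i) := by
      rw [div_le_div_iff₀ (by positivity) (by positivity)]
      nlinarith [mul_nonneg (by linarith : (0 : ℚ) ≤ 2 - a) (by positivity : (0 : ℚ) ≤ (u : ℚ) + 2)]
    -- P(i) ≤ P(0)
    have hP : (((u : ℚ) - i) / ((k : ℚ) + i + 1)) * (((k : ℚ) + i + 3) / ((u : ℚ) + k + 5 + i)) ≤ twoRatio u k := by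
      unfold twoRatio
      rw [div_mul_div_comm, div_le_div_iff₀ (by positivity) (by positivity)]
      have key : (u : ℚ) * (k + 3) * ((k + i + 1) * (u + k + 5 + i)) - ((u : ℚ) - i) * (k + i + 3) * ((k + 1) * (u + k + 5))
          = (i : ℚ) * (2 * u ^ 2 + u * (2 * k ^ 2 + 10 * k + 16) + (k + 1) * (k + 3) * (k + 5))
            + (i : ℚ) ^ 2 * (u * (k + 3) + (k + 1) * (u + k + 5)) := by ring
      have : (0 : ℚ) ≤ (i : ℚ) * (2 * u ^ 2 + u * (2 * k ^ 2 + 10 * k + 16) + (k + 1) * (k + 3) * (k + 5))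
            + (i : ℚ) ^ 2 * (u * (k + 3) + (k + 1) * (u + k + 5)) := by positivity
      linarith
    have hui : (0 : ℚ) ≤ ((u : ℚ) - i) / ((k : ℚ) + i + 1) := by
      apply div_nonneg _ (by positivity); linarith
    calc (((u : ℚ) - i) / ((k : ℚ) + i + 1)) * (((a : ℚ) + (k + i) + 1) / (2 + (u : ℚ) + (k + i) + a + 1))
        ≤ (((u : ℚ) - i) / ((k : ℚ) + i + 1)) * (((k : ℚ) + i + 3) / ((u : ℚ) + k + 5 + i)) :=
          mul_le_mul_of_nonneg_left hA hui
      _ ≤ twoRatio u k := hP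
  rw [div_eq_mul_one_div (((2 : ℕ).choose a : ℚ)), div_eq_mul_one_div (((2 : ℕ).choose a : ℚ)), e1, e2]
  calc ((u + k).choose (k + i) : ℚ) * (((u : ℚ) - i) / ((k : ℚ) + i + 1))
        * (((2 : ℕ).choose a : ℚ) * (((((a + (k + i) : ℕ) : ℚ) + 1) / (((2 + u + (k + i) + a : ℕ) : ℚ) + 1))
          * (1 / ((2 + u + (k + i) + a).choose (a + (k + i)) : ℚ))))
      = (((u + k).choose (k + i) : ℚ) * (((2 : ℕ).choose a : ℚ)
          * (1 / ((2 + u + (k + i) + a).choose (a + (k + i)) : ℚ))))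
        * ((((u : ℚ) - i) / ((k : ℚ) + i + 1))
          * ((((a + (k + i) : ℕ) : ℚ) + 1) / (((2 + u + (k + i) + a : ℕ) : ℚ) + 1))) := by ring
    _ ≤ (((u + k).choose (k + i) : ℚ) * (((2 : ℕ).choose a : ℚ)
          * (1 / ((2 + u + (k + i) + a).choose (a + (k + i)) : ℚ)))) * twoRatio u k :=
        mul_le_mul_of_nonneg_left hr (by positivity)
    _ = _ := by ring

/-- `sliceTwoTerm u k i ≤ sliceTwoTerm u k 0 · P₀^i` for `i ≤ u`. -/
lemma sliceTwoTerm_le_geom (u k : ℕ) : ∀ i : ℕ, i ≤ u → sliceTwoTerm u k i ≤ sliceTwoTerm u k 0 * twoRatio u k ^ i := by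
  intro i
  induction i with
  | zero => intro _; simp
  | succ i ih =>
    intro hi
    calc sliceTwoTerm u k (i + 1) ≤ twoRatio u k * sliceTwoTerm u k i := sliceTwoTerm_succ_le u k i hi
      _ ≤ twoRatio u k * (sliceTwoTerm u k 0 * twoRatio u k ^ i) :=
          mul_le_mul_of_nonneg_left (ih (by omega)) (twoRatio_nonneg u k)
      _ = sliceTwoTerm u k 0 * twoRatio u k ^ (i + 1) := by ring

/-- **The first term of `T_u(2)` exactly**:
`sliceTwoTerm u k 0 = (u+1)(u+2)/((u+k+1)(u+k+2)) · (1 + 2x₁ + x₁x₂)`, `x_b = (k+b)/(u+k+2+b)`. -/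
lemma sliceTwoTerm_zero_eq (u k : ℕ) :
    sliceTwoTerm u k 0
      = (((u : ℚ) + 1) * ((u : ℚ) + 2)) / (((u : ℚ) + k + 1) * ((u : ℚ) + k + 2))
        * (1 + 2 * (((k : ℚ) + 1) / ((u : ℚ) + k + 3)) + (((k : ℚ) + 1) / ((u : ℚ) + k + 3)) * (((k : ℚ) + 2) / ((u : ℚ) + k + 4))) := by
  unfold sliceTwoTerm
  simp only [Finset.sum_range_succ, Finset.sum_range_zero, Nat.add_zero, zero_add]
  rw [show 2 + u + k = u + k + 2 by ring, show u + k + 2 + 1 = u + k + 3 by ring, show u + k + 2 + 2 = u + k + 4 by ring,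
    show 1 + k = k + 1 by ring, show 2 + k = k + 2 by ring]
  simp only [Nat.choose_zero_right, Nat.choose_one_right, Nat.choose_self, Nat.cast_one, Nat.cast_ofNat]
  have r1 := Nat.choose_mul_succ_eq (u + k) k
  have r2 := Nat.choose_mul_succ_eq (u + k + 1) k
  rw [show u + k + 1 - k = u + 1 by omega] at r1
  rw [show u + k + 1 + 1 - k = u + 2 by omega, show u + k + 1 + 1 = u + k + 2 by ring] at r2
  have s1 := Nat.add_one_mul_choose_eq (u + k + 2) k
  have s2 := Nat.add_one_mul_choose_eq (u + k + 3) (k + 1)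
  rw [show u + k + 2 + 1 = u + k + 3 by ring] at s1
  rw [show u + k + 3 + 1 = u + k + 4 by ring, show k + 1 + 1 = k + 2 by ring] at s2
  have c1 := congrArg (fun x : ℕ => (x : ℚ)) r1
  have c2 := congrArg (fun x : ℕ => (x : ℚ)) r2
  have d1 := congrArg (fun x : ℕ => (x : ℚ)) s1
  have d2 := congrArg (fun x : ℕ => (x : ℚ)) s2
  push_cast at c1 c2 d1 d2
  clear r1 r2 s1 s2
  have hB0 : (0 : ℚ) < ((u + k + 2).choose k : ℚ) := Nat.cast_pos.mpr (Nat.choose_pos (by omega))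
  have hB1 : (0 : ℚ) < ((u + k + 3).choose (k + 1) : ℚ) := Nat.cast_pos.mpr (Nat.choose_pos (by omega))
  have hB2 : (0 : ℚ) < ((u + k + 4).choose (k + 2) : ℚ) := Nat.cast_pos.mpr (Nat.choose_pos (by omega))
  have hu1 : (0 : ℚ) < (u : ℚ) + 1 := by positivity
  have hu2 : (0 : ℚ) < (u : ℚ) + 2 := by positivity
  have hk1 : (0 : ℚ) < (k : ℚ) + 1 := by positivity
  have hk2 : (0 : ℚ) < (k : ℚ) + 2 := by positivity
  set A : ℚ := ((u + k).choose k : ℚ) with hAdef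
  set B₀ : ℚ := ((u + k + 2).choose k : ℚ) with hB0def
  set B₁ : ℚ := ((u + k + 3).choose (k + 1) : ℚ) with hB1def
  set B₂ : ℚ := ((u + k + 4).choose (k + 2) : ℚ) with hB2def
  have eA : A * (((u : ℚ) + k + 1) * ((u : ℚ) + k + 2)) = B₀ * (((u : ℚ) + 1) * ((u : ℚ) + 2)) := by
    linear_combination ((u : ℚ) + k + 2) * c1 + ((u : ℚ) + 1) * c2
  have eB1 : B₁ = (((u : ℚ) + k + 3) / ((k : ℚ) + 1)) * B₀ := by
    rw [div_mul_eq_mul_div, eq_div_iff hk1.ne']; linear_combination -d1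
  have eB2 : B₂ = (((u : ℚ) + k + 4) / ((k : ℚ) + 2)) * B₁ := by
    rw [div_mul_eq_mul_div, eq_div_iff hk2.ne']; linear_combination -d2
  have eA' : A = B₀ * (((u : ℚ) + 1) * ((u : ℚ) + 2)) / (((u : ℚ) + k + 1) * ((u : ℚ) + k + 2)) := by
    rw [eq_div_iff (by positivity)]; exact eA
  rw [eB2, eB1, eA']
  have hB0' : B₀ ≠ 0 := hB0.ne'
  have h1 : (u : ℚ) + k + 1 ≠ 0 := by positivity
  have h2 : (u : ℚ) + k + 2 ≠ 0 := by positivity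
  have h3 : (u : ℚ) + k + 3 ≠ 0 := by positivity
  have h4 : (u : ℚ) + k + 4 ≠ 0 := by positivity
  field_simp

/-- **The chain**: `P₂(u, k) < 1 ⇒ sliceTail u k 2 ≤ sliceTwoTerm u k 0 / (1 − P₂(u, k))`. -/
theorem sliceTail_two_le_chain (u k : ℕ) (h : twoRatio u k < 1) :
    sliceTail u k 2 ≤ sliceTwoTerm u k 0 * (1 / (1 - twoRatio u k)) := by
  rw [sliceTail_two_eq]
  have h0 := sliceTwoTerm_nonneg u k 0
  calc ∑ i ∈ range (u + 1), sliceTwoTerm u k i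
      ≤ ∑ i ∈ range (u + 1), sliceTwoTerm u k 0 * twoRatio u k ^ i := by
        apply Finset.sum_le_sum
        intro i hi
        rw [Finset.mem_range] at hi
        exact sliceTwoTerm_le_geom u k i (by omega)
    _ = sliceTwoTerm u k 0 * ∑ i ∈ range (u + 1), twoRatio u k ^ i := by rw [Finset.mul_sum]
    _ ≤ sliceTwoTerm u k 0 * (1 / (1 - twoRatio u k)) :=
        mul_le_mul_of_nonneg_left (sum_geom_le_inv (twoRatio u k) (twoRatio_nonneg u k) h (u + 1)) h0

end PercRepro
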